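import Summits.CriticalPhenomena.PercolationContinuityZ3.Theorems.PercNearOneGluingNoHeavyLowerTailSunflowerLawSaturation
import HarnessLib

/-!
# `NoHeavyLowerTail` (crux stmt-CriticalPhenomena-4575), abstract sunflower cubic at LAW level: the SATURATION REDUCTION, part 2 —
# (C1-law), H-COMB, Lemma A/B and the `G`-row for ALL three-petal sunflowers of up-sets follow from the same rows on the
# GENERALIZED PRODUCT CLASS `PC(W₁,W₂,W₃)` (`E_k = W_k ∪ (W_i ∩ W_j)`, `W_i` ARBITRARY up-sets of the same cube), same `p`

Support file (seat `prim-ineq-gen-2` gen 31; `--supports stmt-CriticalPhenomena-4575`; companion of `…SunflowerLawSaturation`, which has the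
one-move machinery).  Nothing is asserted about the crux; no `sorry`, no named facts, standard axioms.  Memo:
run/shared/lean/prim/prim-ineq-gen-2/BK-STRATUM-GEN31.md §3.

RESULTS:
* `move_step` — one free-core move packaged (new sunflower, saturation of the moved pair, cells grow/shrink, all rows `≤`);
* `exists_pc_le` — **THE REDUCTION**: for every three-petal sunflower of up-sets of a finite cube there are up-sets `W₁, W₂, W₃` of the same cube
  (the up-closures of the petal cells after three moves) such that the generalized product structure `PC(W)` has `LAform`, `LBform`, `Hform`,
  `C1form`, `Gform` all `≤` those of the sunflower, at the same `p`;
* `C1_of_pc`, `lawH_of_pc`, `G_of_pc`, `LB_of_pc` — hence each row for all sunflowers follows from the row on `PC(W₁,W₂,W₃)`, `W_i` arbitrary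
  up-sets: the lane's law-level conjectures are statements about the "none / only-`i` / at-least-two" statistics of THREE ARBITRARY INCREASING
  EVENTS (`b = μ(no Wᵢ)`, `c_i = μ(only Wᵢ)`, `a = μ(≥ 2)`; e.g. (C1-law): `max(a,b)(ab − e₂(c)) ≥ e₃(c)`).  For `W_i` on disjoint supports this is
  the classical product class (`LB ≡ 0`); `LB_of_pc` records that Lemma B alone cannot hold on the whole generalized class (it fails for some
  sunflowers), so the dichotomy is intrinsic there too.
-/

noncomputable section

namespace Summit.CriticalPhenomena.PercolationContinuityZ3.Theorems.SunflowerPartition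

namespace LawSaturation

open MeasureTheory LawPencil LawRegion
open Literature.Probability.LatticeModels Literature.Probability.Percolation

variable {ι : Type*}

/-! ## The reduction -/

section Reduction

variable [Fintype ι]

/-- One move with the rows compared, packaged for an arbitrary ordered pair of petals: the data of the moved sunflower. [this work] -/
theorem move_step (p : ι → unitInterval) {E₁ E₂ E₃ A : Set (Set ι)} (h₁ : IsUpperSet E₁) (h₂ : IsUpperSet E₂)
    (h₃ : IsUpperSet E₃) (h12 : E₁ ∩ E₂ = A) (h13 : E₁ ∩ E₃ = A) (h23 : E₂ ∩ E₃ = A) :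
    ∃ E₁' E₂' A' : Set (Set ι), IsUpperSet E₁' ∧ IsUpperSet E₂' ∧ E₁' ∩ E₂' = A' ∧ E₁' ∩ E₃ = A' ∧ E₂' ∩ E₃ = A' ∧
      A' ⊆ A ∧ E₁ \ A ⊆ E₁' \ A' ∧ E₂ \ A ⊆ E₂' \ A' ∧ E₃ \ A ⊆ E₃ \ A' ∧ Saturated E₁' E₂' A' ∧
      LAform (cells p E₁' E₂' E₃ A') ≤ LAform (cells p E₁ E₂ E₃ A) ∧
      LBform (cells p E₁' E₂' E₃ A') ≤ LBform (cells p E₁ E₂ E₃ A) ∧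
      Hform (cells p E₁' E₂' E₃ A') ≤ Hform (cells p E₁ E₂ E₃ A) ∧
      C1form (cells p E₁' E₂' E₃ A') ≤ C1form (cells p E₁ E₂ E₃ A) ∧
      Gform (cells p E₁' E₂' E₃ A') ≤ Gform (cells p E₁ E₂ E₃ A) := by
  obtain ⟨h₁', h₂', h12', h13', h23'⟩ := sunflower_move h₁ h₂ h12 h13 h23
  obtain ⟨-, hLA, hLB, hH, hC1, hG⟩ := forms_move p h₁ h₂ h₃ h12 h13 h23
  have hMA := freeCore_subset E₁ E₂ A
  refine ⟨E₁ \ freeCore E₁ E₂ A, E₂ \ freeCore E₁ E₂ A, A \ freeCore E₁ E₂ A, h₁', h₂', h12', h13', h23',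
    Set.sdiff_subset, ?_, ?_, ?_, saturated_move, hLA, hLB, hH, hC1, hG⟩
  · rw [sdiff_sdiff_sdiff_eq hMA]
  · rw [sdiff_sdiff_sdiff_eq hMA]
  · exact Set.sdiff_subset_sdiff_right (Set.sdiff_subset)

/-- **THE SATURATION REDUCTION.**  For every three-petal sunflower of up-sets of a finite cube there are up-sets `W₁, W₂, W₃` of the same cube
such that the generalized product structure `PC(W)` has all five rows (Lemma A, Lemma B, H-COMB, (C1-law), `G`-row) `≤` those of the
sunflower, at the same `p`. [this work] -/
theorem exists_pc_le (p : ι → unitInterval) {E₁ E₂ E₃ A : Set (Set ι)} (h₁ : IsUpperSet E₁) (h₂ : IsUpperSet E₂)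
    (h₃ : IsUpperSet E₃) (h12 : E₁ ∩ E₂ = A) (h13 : E₁ ∩ E₃ = A) (h23 : E₂ ∩ E₃ = A) :
    ∃ W₁ W₂ W₃ : Set (Set ι), IsUpperSet W₁ ∧ IsUpperSet W₂ ∧ IsUpperSet W₃ ∧
      LAform (cells p (pcE W₁ W₂ W₃) (pcE W₂ W₁ W₃) (pcE W₃ W₁ W₂) (pcCore W₁ W₂ W₃)) ≤ LAform (cells p E₁ E₂ E₃ A) ∧
      LBform (cells p (pcE W₁ W₂ W₃) (pcE W₂ W₁ W₃) (pcE W₃ W₁ W₂) (pcCore W₁ W₂ W₃)) ≤ LBform (cells p E₁ E₂ E₃ A) ∧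
      Hform (cells p (pcE W₁ W₂ W₃) (pcE W₂ W₁ W₃) (pcE W₃ W₁ W₂) (pcCore W₁ W₂ W₃)) ≤ Hform (cells p E₁ E₂ E₃ A) ∧
      C1form (cells p (pcE W₁ W₂ W₃) (pcE W₂ W₁ W₃) (pcE W₃ W₁ W₂) (pcCore W₁ W₂ W₃)) ≤ C1form (cells p E₁ E₂ E₃ A) ∧
      Gform (cells p (pcE W₁ W₂ W₃) (pcE W₂ W₁ W₃) (pcE W₃ W₁ W₂) (pcCore W₁ W₂ W₃)) ≤ Gform (cells p E₁ E₂ E₃ A) := by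
  -- the forms are symmetric in the petals up to the obvious relabelling of `cells`; we saturate (1,2), then (1,3), then (2,3)
  -- step 1: pair (1,2)
  obtain ⟨F₁, F₂, A₁, hF₁, hF₂, f12, f13, f23, -, -, -, -, sat12, la1, lb1, hh1, c1, gg1⟩ :=
    move_step p h₁ h₂ h₃ h12 h13 h23
  -- step 2: pair (1,3) on the sunflower (F₁, E₃, F₂; A₁) — cells are a permutation (swap petals 2,3), forms are symmetric
  have f32 : E₃ ∩ F₂ = A₁ := by rw [Set.inter_comm]; exact f23
  obtain ⟨G₁, G₃, A₂, hG₁, hG₃, g13', g12', g32', hA₂, k1, -, k2, sat13, la2, lb2, hh2, c2, gg2⟩ :=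
    move_step p hF₁ h₃ hF₂ f13 f12 f32
  -- step 3: pair (2,3) on the sunflower (F₂, G₃, G₁; A₂)
  have g23'' : F₂ ∩ G₃ = A₂ := by rw [Set.inter_comm]; exact g32'
  have g21'' : F₂ ∩ G₁ = A₂ := by rw [Set.inter_comm]; exact g12'
  have g31'' : G₃ ∩ G₁ = A₂ := by rw [Set.inter_comm]; exact g13'
  obtain ⟨H₂, H₃, A₃, hH₂, hH₃, l23, l21, l31, hA₃, n2, n3, n1, sat23, la3, lb3, hh3, c3, gg3⟩ :=
    move_step p hF₂ hG₃ hG₁ g23'' g21'' g31''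
  -- saturation of all three pairs of the final sunflower (G₁, H₂, H₃; A₃)
  have s12 : Saturated G₁ H₂ A₃ := by
    have : Saturated G₁ F₂ A₂ := saturated_of_subset sat12 hA₂ k1 k2
    exact saturated_of_subset this hA₃ n1 n2
  have s13 : Saturated G₁ H₃ A₃ := saturated_of_subset sat13 hA₃ n1 n3
  have s23 : Saturated H₂ H₃ A₃ := sat23
  have e12 : G₁ ∩ H₂ = A₃ := by rw [Set.inter_comm]; exact l21
  have e13 : G₁ ∩ H₃ = A₃ := by rw [Set.inter_comm]; exact l31
  obtain ⟨q1, q2, q3, qA⟩ := eq_pc_of_saturated hG₁ hH₂ hH₃ e12 e13 l23 s12 s13 s23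
  -- symmetry of the forms under the petal permutations used in steps 2 and 3
  have perm : ∀ (X₁ X₂ X₃ Y : Set (Set ι)),
      LAform (cells p X₁ X₃ X₂ Y) = LAform (cells p X₁ X₂ X₃ Y) ∧ LBform (cells p X₁ X₃ X₂ Y) = LBform (cells p X₁ X₂ X₃ Y) ∧
      Hform (cells p X₁ X₃ X₂ Y) = Hform (cells p X₁ X₂ X₃ Y) ∧ C1form (cells p X₁ X₃ X₂ Y) = C1form (cells p X₁ X₂ X₃ Y) ∧
      Gform (cells p X₁ X₃ X₂ Y) = Gform (cells p X₁ X₂ X₃ Y) := by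
    intro X₁ X₂ X₃ Y
    have hu : X₁ ∪ X₃ ∪ X₂ = X₁ ∪ X₂ ∪ X₃ := by ac_rfl
    simp only [LAform, LBform, Hform, C1form, Gform, AGform, cells_apply_zero, cells_apply_one, cells_apply_two,
      cells_apply_three, cells_apply_four, hu]
    refine ⟨by ring, by ring, by ring, by ring, by ring⟩
  have perm' : ∀ (X₁ X₂ X₃ Y : Set (Set ι)),
      LAform (cells p X₂ X₃ X₁ Y) = LAform (cells p X₁ X₂ X₃ Y) ∧ LBform (cells p X₂ X₃ X₁ Y) = LBform (cells p X₁ X₂ X₃ Y) ∧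
      Hform (cells p X₂ X₃ X₁ Y) = Hform (cells p X₁ X₂ X₃ Y) ∧ C1form (cells p X₂ X₃ X₁ Y) = C1form (cells p X₁ X₂ X₃ Y) ∧
      Gform (cells p X₂ X₃ X₁ Y) = Gform (cells p X₁ X₂ X₃ Y) := by
    intro X₁ X₂ X₃ Y
    have hu : X₂ ∪ X₃ ∪ X₁ = X₁ ∪ X₂ ∪ X₃ := by ac_rfl
    simp only [LAform, LBform, Hform, C1form, Gform, AGform, cells_apply_zero, cells_apply_one, cells_apply_two,
      cells_apply_three, cells_apply_four, hu]
    refine ⟨by ring, by ring, by ring, by ring, by ring⟩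
  -- chain the inequalities: final (G₁,H₂,H₃;A₃) ≤ (F₂,G₃,G₁;A₂) ≤ ... careful with argument orders
  obtain ⟨pa2, pb2, ph2, pc2, pg2⟩ := perm F₁ F₂ E₃ A₁      -- cells p F₁ E₃ F₂ A₁ vs cells p F₁ F₂ E₃ A₁
  obtain ⟨pa3, pb3, ph3, pc3, pg3⟩ := perm G₁ G₃ F₂ A₂      -- cells p G₁ F₂ G₃ A₂ vs cells p G₁ G₃ F₂ A₂
  obtain ⟨ra3, rb3, rh3, rc3, rg3⟩ := perm' G₁ F₂ G₃ A₂     -- cells p F₂ G₃ G₁ A₂ vs cells p G₁ F₂ G₃ A₂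
  obtain ⟨sa, sb, sh, sc, sg⟩ := perm' G₁ H₂ H₃ A₃          -- cells p H₂ H₃ G₁ A₃ vs cells p G₁ H₂ H₃ A₃
  refine ⟨upc (G₁ \ A₃), upc (H₂ \ A₃), upc (H₃ \ A₃), isUpperSet_upc _, isUpperSet_upc _, isUpperSet_upc _, ?_, ?_, ?_, ?_, ?_⟩
  · rw [← q1, ← q2, ← q3, ← qA]; linarith
  · rw [← q1, ← q2, ← q3, ← qA]; linarith
  · rw [← q1, ← q2, ← q3, ← qA]; linarith
  · rw [← q1, ← q2, ← q3, ← qA]; linarith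
  · rw [← q1, ← q2, ← q3, ← qA]; linarith

/-- **(C1-law) for all sunflowers of up-sets from (C1-law) on the generalized product class** (same cube, same `p`). [this work] -/
theorem C1_of_pc (p : ι → unitInterval)
    (hPC : ∀ W₁ W₂ W₃ : Set (Set ι), IsUpperSet W₁ → IsUpperSet W₂ → IsUpperSet W₃ →
      0 ≤ C1form (cells p (pcE W₁ W₂ W₃) (pcE W₂ W₁ W₃) (pcE W₃ W₁ W₂) (pcCore W₁ W₂ W₃)))
    {E₁ E₂ E₃ A : Set (Set ι)} (h₁ : IsUpperSet E₁) (h₂ : IsUpperSet E₂) (h₃ : IsUpperSet E₃)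
    (h12 : E₁ ∩ E₂ = A) (h13 : E₁ ∩ E₃ = A) (h23 : E₂ ∩ E₃ = A) :
    0 ≤ C1form (cells p E₁ E₂ E₃ A) := by
  obtain ⟨W₁, W₂, W₃, hW₁, hW₂, hW₃, -, -, -, hC1, -⟩ := exists_pc_le p h₁ h₂ h₃ h12 h13 h23
  exact le_trans (hPC W₁ W₂ W₃ hW₁ hW₂ hW₃) hC1

/-- **H-COMB for all sunflowers of up-sets from H-COMB on the generalized product class** (same cube, same `p`). [this work] -/
theorem lawH_of_pc (p : ι → unitInterval)
    (hPC : ∀ W₁ W₂ W₃ : Set (Set ι), IsUpperSet W₁ → IsUpperSet W₂ → IsUpperSet W₃ →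
      0 ≤ Hform (cells p (pcE W₁ W₂ W₃) (pcE W₂ W₁ W₃) (pcE W₃ W₁ W₂) (pcCore W₁ W₂ W₃)))
    {E₁ E₂ E₃ A : Set (Set ι)} (h₁ : IsUpperSet E₁) (h₂ : IsUpperSet E₂) (h₃ : IsUpperSet E₃)
    (h12 : E₁ ∩ E₂ = A) (h13 : E₁ ∩ E₃ = A) (h23 : E₂ ∩ E₃ = A) :
    0 ≤ Hform (cells p E₁ E₂ E₃ A) := by
  obtain ⟨W₁, W₂, W₃, hW₁, hW₂, hW₃, -, -, hH, -, -⟩ := exists_pc_le p h₁ h₂ h₃ h12 h13 h23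
  exact le_trans (hPC W₁ W₂ W₃ hW₁ hW₂ hW₃) hH

/-- **The `G`-row `AG ≥ e₃` for all sunflowers of up-sets from the `G`-row on the generalized product class**. [this work] -/
theorem G_of_pc (p : ι → unitInterval)
    (hPC : ∀ W₁ W₂ W₃ : Set (Set ι), IsUpperSet W₁ → IsUpperSet W₂ → IsUpperSet W₃ →
      0 ≤ Gform (cells p (pcE W₁ W₂ W₃) (pcE W₂ W₁ W₃) (pcE W₃ W₁ W₂) (pcCore W₁ W₂ W₃)))
    {E₁ E₂ E₃ A : Set (Set ι)} (h₁ : IsUpperSet E₁) (h₂ : IsUpperSet E₂) (h₃ : IsUpperSet E₃)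
    (h12 : E₁ ∩ E₂ = A) (h13 : E₁ ∩ E₃ = A) (h23 : E₂ ∩ E₃ = A) :
    0 ≤ Gform (cells p E₁ E₂ E₃ A) := by
  obtain ⟨W₁, W₂, W₃, hW₁, hW₂, hW₃, -, -, -, -, hG⟩ := exists_pc_le p h₁ h₂ h₃ h12 h13 h23
  exact le_trans (hPC W₁ W₂ W₃ hW₁ hW₂ hW₃) hG

/-- **Lemma B transfers too**: `LB ≥ 0` for every `PC(W)` at `p` would give Lemma B for every sunflower at `p` — recorded because it shows the
reduction cannot be combined with a `p`-independent proof of Lemma B on the product class (Lemma B fails for some sunflowers), i.e. Lemma B is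
FALSE on the generalized product class for suitable dependent `W_i`. [this work] -/
theorem LB_of_pc (p : ι → unitInterval)
    (hPC : ∀ W₁ W₂ W₃ : Set (Set ι), IsUpperSet W₁ → IsUpperSet W₂ → IsUpperSet W₃ →
      0 ≤ LBform (cells p (pcE W₁ W₂ W₃) (pcE W₂ W₁ W₃) (pcE W₃ W₁ W₂) (pcCore W₁ W₂ W₃)))
    {E₁ E₂ E₃ A : Set (Set ι)} (h₁ : IsUpperSet E₁) (h₂ : IsUpperSet E₂) (h₃ : IsUpperSet E₃)
    (h12 : E₁ ∩ E₂ = A) (h13 : E₁ ∩ E₃ = A) (h23 : E₂ ∩ E₃ = A) :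
    0 ≤ LBform (cells p E₁ E₂ E₃ A) := by
  obtain ⟨W₁, W₂, W₃, hW₁, hW₂, hW₃, -, hLB, -, -, -⟩ := exists_pc_le p h₁ h₂ h₃ h12 h13 h23
  exact le_trans (hPC W₁ W₂ W₃ hW₁ hW₂ hW₃) hLB

end Reduction

end LawSaturation

end Summit.CriticalPhenomena.PercolationContinuityZ3.Theorems.SunflowerPartition

end
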